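import Literature.NumberTheory.LFunctions.ClassGroupLFunctionQuadraticClassField
import Literature.NumberTheory.LFunctions.StarkNoQuadraticSubfieldProofs
import Literature.NumberTheory.NumberFields.OddDegreeUnramifiedNoQuadraticSubfield
import Literature.NumberTheory.NumberFields.ClassFieldsOfCharactersUniqueness
import Literature.NumberTheory.NumberFields.UnramifiedDiscriminant
import HarnessLib

/-!
# No exceptional (Landau–Siegel) zero for the class group `L`-functions of a number field of ODD degree

Topic `Literature/NumberTheory/LFunctions`, namespace `Literature.NumberTheory.LFunctions.NumberField`.
Theorem-only file (no definition, no named fact), unconditional.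

**Theorem** (`classGroupLFunction_ne_zero_of_odd`).  Let `K` be a number field of odd degree `n > 1`
and `χ : Cl(𝓞 K) → ℂˣ` a REAL class group character (`χ² = 1`, the trivial character included).  Then
`L(σ, χ) ≠ 0` for every real `σ` with `1 − 1/(8·(2n)!·log|d_K|) ≤ σ < 1`.
In particular (`classGroupLFunction_ne_zero_of_finrank_eq_three`): for every CUBIC field `K` and every
real class group character `χ`, `L(σ, χ) ≠ 0` on `[1 − 1/(5760·log|d_K|), 1)`.

Proof (Stark 1974 twice, plus class field theory).
* `χ = 1`: `L(s, 1) = ζ_K(s)` and `K`, of odd degree, has no quadratic subfield, so Stark's theorem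
  (tree: `Stark1974_dedekindZeta_ne_zero_of_noQuadraticSubfield_holds`) gives `ζ_K(σ) ≠ 0` on
  `[1 − 1/(4·n!·log|d_K|), 1)`.
* `χ ≠ 1`: the tree's global class field theory (`exists_classField_char_frobenius`) provides the class
  field `E ⊆ K̄` of `χ`: Galois over `K`, unramified at every finite prime, with the splitting law
  "`v` splits in `E` iff `χ([v]) = 1`" (`mem_splitPrimes_iff_eq_one_of_classField`) and
  `[E:K] = |χ(Cl)| = 2` (`finrank_eq_card_range_of_classField`).  Hence `ζ_E = ζ_K · L(s, χ)`
  (`dedekindZetaCont_eq_zero_of_classGroupLFunction_eq_zero`), `|d_E| = |d_K|²`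
  (`natAbs_discr_eq_pow_of_forall_isUnramifiedAt`), `[E:ℚ] = 2n`, and — the new point — **`E` has no
  quadratic subfield because `[K:ℚ]` is odd** (`finrank_ne_two_of_forall_isUnramifiedAt_of_odd`: a
  quadratic `F ⊆ E` would force every ramification index above a prime `p ∣ d_F` to be even, making
  `[K:ℚ] = Σ e f` even).  Stark's theorem for `E` then forbids a zero of `ζ_E`, hence of `L(s, χ)`, on
  `[1 − 1/(4·(2n)!·log|d_E|), 1) = [1 − 1/(8·(2n)!·log|d_K|), 1)`.

So in odd degree the exceptional alternative of the Landau–Page / Thorner–Zaman dichotomy for the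
Hilbert class field NEVER occurs (with an explicit, effective constant); compare Thorner–Zaman 2019,
Thm. 1.4, where a possible exceptional zero `β₁` of a real Hecke character must be carried along.
For the route QuantumAdvantage/LinnikCubicClassGroups (cell B2b-1) this removes the exceptional term from
the class prime number theorem of EVERY cubic field (not only those of odd class number).

## References

* H. M. Stark, *Some effective cases of the Brauer–Siegel theorem*, Invent. Math. 23 (1974) 135–152,
  Thm. 3 / Lemma 3 (via the tree's `StarkNoQuadraticSubfieldProofs`). [Stark1974]
* J. Thorner, A. Zaman, *A unified and improved Chebotarev density theorem*, Algebra Number Theory 13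
  (2019), Thm. 1.4 and §3 (the exceptional zero `β₁`). [ThornerZaman2019]
* D. A. Cox, *Primes of the form x² + ny²*, 2nd ed. (2013), §5.C Cor. 5.24, §8.A Thm. 8.10 (class
  fields of class group characters). [Cox2013]
* J. Neukirch, *Algebraic Number Theory* (1999), Ch. III (2.6), (2.9)–(2.10); Ch. VII (10.4)–(10.6).
  [NeukirchANT1999]
-/

noncomputable section

open scoped NumberField nonZeroDivisors
open Complex NumberField IsDedekindDomain Module

namespace Literature.NumberTheory.LFunctions.NumberField

open Literature.NumberTheory.GaloisRepresentations Literature.NumberTheory.NumberFields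
  Literature.NumberTheory.LFunctions

/-- A number field of odd degree has no quadratic subfield (tower law). [folklore] -/
theorem forall_finrank_ne_two_of_odd {K : Type*} [Field K] [NumberField K] (hodd : Odd (finrank ℚ K)) :
    ∀ F : IntermediateField ℚ K, finrank ℚ F ≠ 2 := by
  intro F hF
  have hdvd : finrank ℚ F ∣ finrank ℚ K := Dvd.intro _ (Module.finrank_mul_finrank ℚ F K)
  rw [hF] at hdvd
  exact (Nat.not_even_iff_odd.mpr hodd) (even_iff_two_dvd.mpr hdvd)

/-- The image of a non-trivial real character has two elements. [folklore] -/
theorem card_range_eq_two_of_real {K : Type} [Field K] [NumberField K] {χ : ClassGroup (𝓞 K) →* ℂˣ}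
    (hχ : χ * χ = 1) (hχ1 : χ ≠ 1) : Nat.card χ.range = 2 := by
  have hidx := Heilbronn.index_ker_eq_two_of_sign (classGroupChar_apply_eq_one_or_eq_neg_one hχ) hχ1
  rwa [Subgroup.index_ker] at hidx

/-- **The class field of a non-trivial real class group character and its zeta function.**  For
`K : Type` a number field and `χ ≠ 1` real there is a number field `E ⊇ K` inside `K̄`, Galois of degree
`2` over `K`, with every maximal ideal of `𝓞 E` unramified over `𝓞 K`, `|d_E| = |d_K|²`, and such that
every zero `s ≠ 1` of `L(s, χ)` is a zero of `ζ_E` (tree CFT `exists_classField_char_frobenius`,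
splitting law, `ζ_E = ζ_K·L(s,χ)`). [cite: Cox2013, §5.C Cor. 5.24 and §8.A Thm. 8.10]
[cite: NeukirchANT1999, Ch. VII (10.4)–(10.6)] -/
theorem exists_quadratic_classField_dedekindZetaCont_eq_zero {K : Type} [Field K] [NumberField K]
    (χ : ClassGroup (𝓞 K) →* ℂˣ) (hχ : χ * χ = 1) (hχ1 : χ ≠ 1) :
    ∃ (E : IntermediateField K (AlgebraicClosure K)) (_ : FiniteDimensional K E) (_ : IsGalois K E),
      finrank K E = 2 ∧
      (∀ (P : Ideal (𝓞 E)) [P.IsMaximal], Algebra.IsUnramifiedAt (𝓞 K) P) ∧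
      (∀ s : ℂ, s ≠ 1 → classGroupLFunction K χ s = 0 →
        @dedekindZetaCont E _ (NumberField.of_module_finite K E) s = 0) := by
  classical
  obtain ⟨E, hfd, hgal, χg, hcomm, hinj, hunr, hfrob⟩ := exists_classField_char_frobenius χ
  haveI := hfd
  haveI := hgal
  haveI : NumberField E := NumberField.of_module_finite K E
  -- `[E:K] = |χ(Cl)| = 2`
  have h2 : finrank K E = 2 := by
    rw [finrank_eq_card_range_of_classField χ E χg hcomm hinj hfrob, card_range_eq_two_of_real hχ hχ1]
  -- unramified at every maximal ideal
  have hunrAt : ∀ (P : Ideal (𝓞 E)) [P.IsMaximal], Algebra.IsUnramifiedAt (𝓞 K) P := by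
    intro P hP
    have hPne : P ≠ ⊥ := Ring.ne_bot_of_isMaximal_of_not_isField hP (RingOfIntegers.not_isField E)
    set v : HeightOneSpectrum (𝓞 K) := HeightOneSpectrum.under (𝓞 K) ⟨P, hP.isPrime, hPne⟩ with hv
    have hPv : P.LiesOver v.asIdeal := ⟨rfl⟩
    exact (Algebra.isUnramifiedIn_iff_forall_of_isDedekindDomain.mp (hunr v)) P hP hPv
  -- the splitting law, in `ℂ`
  have hsplit : ∀ v : HeightOneSpectrum (𝓞 K), v ∈ splitPrimes K E ↔ classGroupCharPrimeValue χ v = 1 := by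
    intro v
    rw [mem_splitPrimes_iff_eq_one_of_classField χ E χg hinj hunr hfrob v, classGroupCharPrimeValue_apply,
      Units.val_eq_one]
  refine ⟨E, hfd, hgal, h2, hunrAt, fun s hs h0 => ?_⟩
  exact dedekindZetaCont_eq_zero_of_classGroupLFunction_eq_zero E h2 hunr χ hχ hχ1 hsplit hs h0

/-- **No exceptional zero in odd degree.**  Let `K` be a number field of ODD degree `n > 1` and `χ` a
real class group character of `K` (`χ² = 1`; `χ = 1`, i.e. `ζ_K`, included).  Then `L(σ, χ) ≠ 0` for
every real `σ` with `1 − 1/(8·(2n)!·log|d_K|) ≤ σ < 1`.  (Stark's theorem for `K` if `χ = 1`, and for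
the quadratic class field `E` of `χ` if `χ ≠ 1`: `[E:ℚ] = 2n`, `|d_E| = |d_K|²`, and `E` has no
quadratic subfield since `n` is odd.) [cite: Stark1974, Thm. 3 and Lemma 3]
[cite: ThornerZaman2019, Thm. 1.4 and §3] -/
theorem classGroupLFunction_ne_zero_of_odd (K : Type) [Field K] [NumberField K]
    (hodd : Odd (finrank ℚ K)) (hK : 1 < finrank ℚ K) (χ : ClassGroup (𝓞 K) →* ℂˣ) (hχ : χ * χ = 1)
    {σ : ℝ}
    (hσ : 1 - 1 / (8 * ((2 * finrank ℚ K).factorial : ℝ) * Real.log ((discr K).natAbs : ℝ)) ≤ σ)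
    (hσ1 : σ < 1) : classGroupLFunction K χ σ ≠ 0 := by
  classical
  set n : ℕ := finrank ℚ K with hn
  -- `|d_K| ≥ 3`, `log|d_K| > 0`
  have hd3 : (3 : ℝ) ≤ ((discr K).natAbs : ℝ) := by
    have h2 := NumberField.abs_discr_gt_two hK
    rw [Nat.cast_natAbs]
    exact_mod_cast (show (3 : ℤ) ≤ |discr K| by omega)
  have hlog : 0 < Real.log ((discr K).natAbs : ℝ) := Real.log_pos (by linarith)
  have hne1 : ((σ : ℝ) : ℂ) ≠ 1 := by
    intro h; apply hσ1.ne; exact_mod_cast h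
  have hfac0 : (0 : ℝ) < ((2 * n).factorial : ℝ) := by exact_mod_cast Nat.factorial_pos _
  by_cases hχ1 : χ = 1
  · -- `χ = 1`: Stark for `K` itself
    subst hχ1
    rw [classGroupLFunction_one K hne1]
    have hnq := forall_finrank_ne_two_of_odd hodd
    refine Stark1974_dedekindZeta_ne_zero_of_noQuadraticSubfield_holds K hnq σ ?_ hσ1
    -- `1 − 1/(4·n!·log d) ≤ 1 − 1/(8·(2n)!·log d) ≤ σ`
    have hfacn0 : (0 : ℝ) < ((n).factorial : ℝ) := by exact_mod_cast Nat.factorial_pos _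
    have hle : ((n).factorial : ℝ) ≤ ((2 * n).factorial : ℝ) := by
      exact_mod_cast Nat.factorial_le (by omega)
    have h1 : 1 / (8 * ((2 * n).factorial : ℝ) * Real.log ((discr K).natAbs : ℝ)) ≤
        1 / (4 * ((n).factorial : ℝ) * Real.log ((discr K).natAbs : ℝ)) := by
      apply one_div_le_one_div_of_le (by positivity)
      nlinarith
    linarith
  · -- `χ ≠ 1`: Stark for the quadratic class field `E` of `χ`
    obtain ⟨E, hfd, hgal, h2, hunrAt, hzero⟩ := exists_quadratic_classField_dedekindZetaCont_eq_zero χ hχ hχ1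
    haveI := hfd
    haveI := hgal
    haveI : NumberField E := NumberField.of_module_finite K E
    intro h0
    have hζE : dedekindZetaCont E σ = 0 := hzero σ hne1 h0
    -- `E` has no quadratic subfield, degree `2n`, discriminant `d_K²`
    have hnq : ∀ F : IntermediateField ℚ E, finrank ℚ F ≠ 2 :=
      finrank_ne_two_of_forall_isUnramifiedAt_of_odd (K := K) hodd hunrAt
    have hdegE : finrank ℚ E = 2 * n := by
      rw [← Module.finrank_mul_finrank ℚ K E, h2, hn, mul_comm]
    have hdiscE : ((discr E).natAbs : ℝ) = ((discr K).natAbs : ℝ) ^ 2 := by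
      rw [natAbs_discr_eq_pow_of_forall_isUnramifiedAt (K := K) hunrAt, h2]
      push_cast
      ring
    refine Stark1974_dedekindZeta_ne_zero_of_noQuadraticSubfield_holds E hnq σ ?_ hσ1 hζE
    rw [hdegE, hdiscE, Real.log_pow]
    push_cast
    have : 1 / (4 * ((2 * n).factorial : ℝ) * (2 * Real.log ((discr K).natAbs : ℝ))) =
        1 / (8 * ((2 * n).factorial : ℝ) * Real.log ((discr K).natAbs : ℝ)) := by
      congr 1; ring
    rw [this]
    exact hσ

/-- **Cubic fields: no exceptional zero at all.**  For every number field `K` of degree `3` and every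
real class group character `χ` (trivial or not), `L(σ, χ) ≠ 0` for `1 − 1/(5760·log|d_K|) ≤ σ < 1`
(`8 · 6! = 5760`). [cite: Stark1974, Thm. 3 and Lemma 3] -/
theorem classGroupLFunction_ne_zero_of_finrank_eq_three (K : Type) [Field K] [NumberField K]
    (hK : finrank ℚ K = 3) (χ : ClassGroup (𝓞 K) →* ℂˣ) (hχ : χ * χ = 1) {σ : ℝ}
    (hσ : 1 - 1 / (5760 * Real.log ((discr K).natAbs : ℝ)) ≤ σ) (hσ1 : σ < 1) :
    classGroupLFunction K χ σ ≠ 0 := by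
  refine classGroupLFunction_ne_zero_of_odd K (by rw [hK]; exact ⟨1, rfl⟩) (by rw [hK]; norm_num) χ hχ
    ?_ hσ1
  rw [hK]
  have hf : ((2 * 3).factorial : ℝ) = 720 := by norm_num [Nat.factorial]
  rw [hf, show (8 : ℝ) * 720 = 5760 by norm_num]
  exact hσ

end Literature.NumberTheory.LFunctions.NumberField

end
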